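import Summits.NavierStokesRegularity.NavierStokesRegularity.Theses.GaldiLiouvilleGate
import Summits.NavierStokesRegularity.NavierStokesRegularity.Theorems.LiouvilleConjectureNS
import Literature.Analysis.FluidPDE.KNSSAxisymmetricNoSwirlHolds
import Literature.Analysis.FluidPDE.KNSSThm53OfWindow
import HarnessLib

/-!
# Crux `ParabolicGaldiLiouville` (stmt-NavierStokesRegularity-0893): the cases known now, and the
# upper half of the sandwich `(L) ⇒ X2`

Helper file of the line lead of the birth line (theorems only; no sorry, standard axioms).

X2 = `GaldiLiouvilleGate.ParabolicGaldiLiouville`: a smooth bounded ancient mild solution `v` of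
Navier–Stokes (`ν = 1`) on `ℝ³ × (−∞,0)` with uniformly bounded enstrophy and `L⁶` slices is
`≡ 0`. Together with `GaldiLiouvilleGateParabolicGaldiLiouvilleTightness.lean`
(`X2 ⇒ GaldiLiouville`) this file places the crux in Lean between two named Liouville statements,

  `LiouvilleConjectureNS (L, open)  ⇒  X2  ⇒  GaldiLiouville (X_G, crux 0895, open)`,

and records the two symmetric sub-classes of X2 that the tree's PROVED Liouville theorems of
Koch–Nadirashvili–Seregin–Šverák (Acta Math. 203 (2009), Thms 5.2 and 5.3) already settle — the
route's "first calibration: axisymmetric class":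

* `eq_zero_of_ae_const_slice` — in the class of X2 an a.e.-constant slice vanishes identically
  (`L⁶(ℝ³)` contains no non-zero constant since `volume ℝ³ = ∞`; continuity upgrades a.e. to
  everywhere). This is the only place where the hypotheses `v(s) ∈ L⁶` and smoothness enter.
* `parabolicGaldiLiouville_of_liouvilleConjectureNS : LiouvilleConjectureNS → ParabolicGaldiLiouville`
  (conditional on the KNSS conjecture (L) = `Theorems/LiouvilleConjectureNS.lean`, a
  `@[conjecture]` leaf; nothing is asserted about (L)).
* `parabolicGaldiLiouville_axisymmetric_noSwirl` — X2 HOLDS for flows that are axisymmetric with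
  no swirl at every `t < 0` (KNSS Thm 5.2, tree theorem `knss_axisymmetric_no_swirl'_holds`;
  unconditional; the enstrophy bound is not even used).
* `parabolicGaldiLiouville_axisymmetric_bound_C_over_r` — X2 HOLDS for axisymmetric flows (swirl
  allowed) with `r ‖v(t,x)‖ ≤ C` (KNSS Thm 5.3, tree theorem `knss_bound_C_over_r_holds`;
  unconditional; neither `L⁶` nor the enstrophy bound is used).

So every hypothesis-free progress on X2 beyond these cases must use the enstrophy/`L⁶` structure in
a way the bounded class (L) cannot — which is the content of the line's open stub
`stub_finiteDissipation`.
-/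

noncomputable section

set_option linter.dupNamespace false

namespace Summit.NavierStokesRegularity.NavierStokesRegularity.Theorems.ParabolicGaldiLiouville.Birth

open MeasureTheory Filter Topology Set Function
open scoped ENNReal NNReal
open Literature.Analysis.FluidPDE

namespace KnownCases

/-- Slices of a field continuous on `(−∞,0) × ℝ³` are continuous. -/
theorem continuous_slice {v : ℝ → EuclideanSpace ℝ (Fin 3) → EuclideanSpace ℝ (Fin 3)}
    (hc : ContinuousOn (uncurry v) (Iio 0 ×ˢ univ)) {t : ℝ} (ht : t < 0) : Continuous (v t) :=
  hc.comp_continuous (continuous_const.prodMk continuous_id) fun y => ⟨ht, mem_univ y⟩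

/-- `volume ℝ³ = ∞` (Lebesgue measure of a non-compact group is infinite). -/
theorem volume_univ_eq_top : (volume : Measure (EuclideanSpace ℝ (Fin 3))) univ = ∞ :=
  measure_univ_of_isAddLeftInvariant _

/-- **An a.e.-constant slice in the class of X2 vanishes identically.** If `v` is continuous on
`(−∞,0) × ℝ³`, `v(t) ∈ L⁶(ℝ³)` and `v(t) = b` a.e. for some constant `b`, then `v t y = 0` for
every `y`: `L⁶(ℝ³)` contains no non-zero constant (`memLp_const_iff`, `volume ℝ³ = ∞`), and a
continuous function a.e. equal to `0` is `0` (`Continuous.ae_eq_iff_eq`). -/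
theorem eq_zero_of_ae_const_slice {v : ℝ → EuclideanSpace ℝ (Fin 3) → EuclideanSpace ℝ (Fin 3)}
    (hc : ContinuousOn (uncurry v) (Iio 0 ×ˢ univ)) {t : ℝ} (ht : t < 0)
    (hL6 : MemLp (v t) 6 volume) {b : EuclideanSpace ℝ (Fin 3)}
    (hae : v t =ᵐ[volume] fun _ => b) : ∀ y, v t y = 0 := by
  have hb : MemLp (fun _ : EuclideanSpace ℝ (Fin 3) => b) 6 volume := hL6.ae_eq hae
  have hb0 : b = 0 := by
    rcases (memLp_const_iff (by norm_num) (by norm_num)).1 hb with h | h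
    · exact h
    · exact absurd h (by rw [volume_univ_eq_top]; exact lt_irrefl _)
  subst hb0
  have hzero : v t = fun _ => 0 :=
    (Continuous.ae_eq_iff_eq volume (continuous_slice hc ht) continuous_const).1 hae
  exact fun y => congrFun hzero y

end KnownCases

open KnownCases

/-- **The KNSS Liouville conjecture implies X2: `LiouvilleConjectureNS → ParabolicGaldiLiouville`.**
(L) makes every slice of a bounded ancient mild solution with measurable slices a.e. constant; in
the class of X2 the slices are continuous (hence measurable) and in `L⁶(ℝ³)`, so the constant is
`0` and the slice vanishes identically (`eq_zero_of_ae_const_slice`). Conditional on the open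
conjecture (L) (Koch–Nadirashvili–Seregin–Šverák 2009, §1), which is a `@[conjecture]` leaf of the
tree; the enstrophy bound is not used. -/
theorem parabolicGaldiLiouville_of_liouvilleConjectureNS :
    Summit.NavierStokesRegularity.NavierStokesRegularity.LiouvilleConjectureNS →
      Summit.NavierStokesRegularity.NavierStokesRegularity.Theses.GaldiLiouvilleGate.ParabolicGaldiLiouville := by
  intro hL v hv hsm _ hL6 s hs
  have hc : ContinuousOn (uncurry v) (Iio 0 ×ˢ univ) := hsm.continuousOn
  have hmeas : ∀ t < 0, AEStronglyMeasurable (v t) volume := fun t ht =>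
    (continuous_slice hc ht).aestronglyMeasurable
  obtain ⟨b, hb⟩ := hL v hv hmeas s hs
  exact eq_zero_of_ae_const_slice hc hs (hL6 s hs) hb

/-- **X2 holds in the axisymmetric swirl-free class (KNSS 2009, Thm 5.2 — proved in the tree).**
A bounded ancient mild solution of Navier–Stokes (`ν = 1`), smooth on `(−∞,0) × ℝ³`, with `L⁶`
slices, which is axisymmetric with no swirl at every `t < 0`, vanishes identically: by
`knss_axisymmetric_no_swirl'_holds` every slice is a.e. a constant vector, and
`eq_zero_of_ae_const_slice` kills it. Unconditional; the enstrophy hypothesis of X2 is carried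
but not used. -/
theorem parabolicGaldiLiouville_axisymmetric_noSwirl :
    ∀ v : ℝ → EuclideanSpace ℝ (Fin 3) → EuclideanSpace ℝ (Fin 3),
      Literature.Analysis.FluidPDE.IsBoundedAncientMildSolution 1 v →
      ContDiffOn ℝ (⊤ : ℕ∞) (Function.uncurry v) (Set.Iio 0 ×ˢ Set.univ) →
      (∃ C : NNReal, ∀ s < 0, ∫⁻ y, ENNReal.ofReal
          (Literature.Analysis.FluidPDE.frobeniusNormSq (fderiv ℝ (v s) y)) ≤ C) →
      (∀ s < 0, MeasureTheory.MemLp (v s) 6 MeasureTheory.volume) →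
      (∀ t < 0, Literature.Analysis.FluidPDE.IsAxisymmetric (v t)) →
      (∀ t < 0, Literature.Analysis.FluidPDE.HasNoSwirl (v t)) →
      ∀ s < 0, ∀ y, v s y = 0 := by
  intro v hv hsm _ hL6 haxi hswirl s hs
  have hc : ContinuousOn (uncurry v) (Iio 0 ×ˢ univ) := hsm.continuousOn
  have hmeas : ∀ t < 0, AEStronglyMeasurable (v t) volume := fun t ht =>
    (continuous_slice hc ht).aestronglyMeasurable
  obtain ⟨b, hb⟩ := knss_axisymmetric_no_swirl'_holds hv hmeas haxi hswirl s hs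
  exact eq_zero_of_ae_const_slice hc hs (hL6 s hs) hb

/-- **X2 holds in the axisymmetric class under `|v| ≤ C/r` (KNSS 2009, Thm 5.3 — proved in the
tree).** A bounded ancient mild solution of Navier–Stokes (`ν = 1`), smooth on `(−∞,0) × ℝ³`,
axisymmetric at every `t < 0` (swirl allowed) with `r ‖v(t,x)‖ ≤ C` (`r` the distance to the
axis), vanishes identically: `knss_bound_C_over_r_holds` gives `v(t) = 0` a.e. on every slice and
continuity upgrades this to everywhere. Unconditional; neither the `L⁶` nor the enstrophy
hypothesis of X2 is used. -/
theorem parabolicGaldiLiouville_axisymmetric_bound_C_over_r :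
    ∀ v : ℝ → EuclideanSpace ℝ (Fin 3) → EuclideanSpace ℝ (Fin 3),
      Literature.Analysis.FluidPDE.IsBoundedAncientMildSolution 1 v →
      ContDiffOn ℝ (⊤ : ℕ∞) (Function.uncurry v) (Set.Iio 0 ×ˢ Set.univ) →
      (∃ C : NNReal, ∀ s < 0, ∫⁻ y, ENNReal.ofReal
          (Literature.Analysis.FluidPDE.frobeniusNormSq (fderiv ℝ (v s) y)) ≤ C) →
      (∀ s < 0, MeasureTheory.MemLp (v s) 6 MeasureTheory.volume) →
      (∀ t < 0, Literature.Analysis.FluidPDE.IsAxisymmetric (v t)) →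
      (∃ C : ℝ, ∀ t < 0, ∀ x, Literature.Analysis.FluidPDE.cylRadius x * ‖v t x‖ ≤ C) →
      ∀ s < 0, ∀ y, v s y = 0 := by
  intro v hv hsm _ _ haxi hbound s hs
  have hc : ContinuousOn (uncurry v) (Iio 0 ×ˢ univ) := hsm.continuousOn
  have hmeas : ∀ t < 0, AEStronglyMeasurable (v t) volume := fun t ht =>
    (continuous_slice hc ht).aestronglyMeasurable
  have hae : v s =ᵐ[volume] 0 := knss_bound_C_over_r_holds hv hmeas haxi hbound s hs
  have hzero : v s = fun _ => 0 :=
    (Continuous.ae_eq_iff_eq volume (continuous_slice hc hs) continuous_const).1 hae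
  exact fun y => congrFun hzero y

end Summit.NavierStokesRegularity.NavierStokesRegularity.Theorems.ParabolicGaldiLiouville.Birth

end
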